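import Mathlib.Analysis.SpecialFunctions.PolarCoord
import Mathlib.MeasureTheory.Measure.Lebesgue.EqHaar
import Mathlib.MeasureTheory.Constructions.Pi

/-!
# Solid angles I: the volume of a circular sector and of a standard spherical wedge

Support file for `FiniteFourierModeEuler` (N. Kishimoto, T. Yoneda, J. Math. Fluid Mech. 24
(2022) 74 = arXiv:2110.08039). The proof of Prop. 4.4 (iv) / Prop. 4.7 uses the AREA of spherical
polygons ("`Ŝ^{conv}` has at least six faces, hence a face with `A(F̂*) ≤ 2π/3`", and Lemma 4.6 via
Gauss–Bonnet). We measure solid angles by Lebesgue VOLUME of cones inside the round ball (which is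
additive for free) and compute here the basic constant: a wedge of opening angle `α` between two
half planes through an axis occupies the fraction `α / (2π)` of the ball.

* `volume_sector₂_eq`: in `ℝ²`, the open circular sector of angle `α ∈ (0, π]` has
  `α / (2π)` of the area of the disc (polar coordinates, `lintegral_comp_polarCoord_symm`);
* `volume_stdWedge_inter_ball`: in `ℝ³ = Fin 3 → ℝ`, the standard wedge
  `{x | 0 < x₁, 0 < x₀ sin α - x₁ cos α}` meets the round ball `{x ⬝ᵥ x < R}` in `α / (2π)` of
  its volume (Fubini over the axis coordinate).

## References

* [KishimotoYoneda2022] N. Kishimoto, T. Yoneda, J. Math. Fluid Mech. 24 (2022) 74 =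
  arXiv:2110.08039, §4 Lemma 4.6 and proof of Prop. 4.4 (iv) (areas of spherical polygons).
* [folklore] volume of wedges and sectors.
-/

noncomputable section

open MeasureTheory Set Real ENNReal

namespace Literature.Analysis.FluidPDE

namespace KY

/-! ### Dimension two: circular sectors -/

/-- The open disc `{x² + y² < ρ}` of radius `√ρ`. [folklore] -/
def disc₂ (ρ : ℝ) : Set (ℝ × ℝ) := {w | w.1 ^ 2 + w.2 ^ 2 < ρ}

/-- The open circular sector of the disc `{x² + y² < ρ}` between the polar angles `0` and `α`
(`0 < α ≤ π`), written with half planes. [folklore] -/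
def sector₂ (α ρ : ℝ) : Set (ℝ × ℝ) :=
  {w | w.1 ^ 2 + w.2 ^ 2 < ρ ∧ 0 < w.2 ∧ 0 < w.1 * Real.sin α - w.2 * Real.cos α}

/-- The disc is measurable. [folklore] -/
theorem measurableSet_disc₂ (ρ : ℝ) : MeasurableSet (disc₂ ρ) := by
  have hc : Continuous fun w : ℝ × ℝ => w.1 ^ 2 + w.2 ^ 2 := by fun_prop
  exact (isOpen_lt hc continuous_const).measurableSet

/-- The sector is measurable. [folklore] -/
theorem measurableSet_sector₂ (α ρ : ℝ) : MeasurableSet (sector₂ α ρ) := by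
  have h1 : MeasurableSet {w : ℝ × ℝ | w.1 ^ 2 + w.2 ^ 2 < ρ} := measurableSet_disc₂ ρ
  have h2 : MeasurableSet {w : ℝ × ℝ | 0 < w.2} :=
    (isOpen_lt continuous_const (by fun_prop)).measurableSet
  have h3 : MeasurableSet {w : ℝ × ℝ | 0 < w.1 * Real.sin α - w.2 * Real.cos α} :=
    (isOpen_lt continuous_const (by fun_prop)).measurableSet
  have : sector₂ α ρ = {w : ℝ × ℝ | w.1 ^ 2 + w.2 ^ 2 < ρ} ∩ {w | 0 < w.2}
      ∩ {w | 0 < w.1 * Real.sin α - w.2 * Real.cos α} := by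
    ext w; simp [sector₂, and_assoc]
  rw [this]
  exact (h1.inter h2).inter h3

/-- The radial integral common to all sectors of the disc of radius `√ρ`. [folklore] -/
def radial (ρ : ℝ) : ℝ≥0∞ := ∫⁻ r in Ioo 0 (Real.sqrt ρ), ENNReal.ofReal r

/-- Polar coordinates of a point of the sector: for `r > 0`, `φ ∈ (-π, π)`,
`(r cos φ, r sin φ) ∈ sector₂ α ρ ↔ r < √ρ ∧ 0 < φ < α`. [folklore] -/
theorem polarCoord_symm_mem_sector₂ {α ρ r φ : ℝ} (hα : 0 < α) (hαπ : α ≤ π) (hr : 0 < r)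
    (hφ : φ ∈ Ioo (-π) π) :
    polarCoord.symm (r, φ) ∈ sector₂ α ρ ↔ r < Real.sqrt ρ ∧ 0 < φ ∧ φ < α := by
  rw [polarCoord_symm_apply]
  simp only [sector₂, mem_setOf_eq]
  have hr2 : (r * Real.cos φ) ^ 2 + (r * Real.sin φ) ^ 2 = r ^ 2 := by
    nlinarith [Real.cos_sq_add_sin_sq φ]
  rw [hr2]
  have hsub : r * Real.cos φ * Real.sin α - r * Real.sin φ * Real.cos α = r * Real.sin (α - φ) := by
    rw [Real.sin_sub]; ring
  rw [hsub]
  have e1 : r ^ 2 < ρ ↔ r < Real.sqrt ρ := by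
    rw [← Real.sqrt_lt_sqrt_iff (sq_nonneg r), Real.sqrt_sq hr.le]
  have e2 : 0 < r * Real.sin φ ↔ 0 < φ := by
    rw [mul_pos_iff_of_pos_left hr]
    constructor
    · intro h
      by_contra hle
      rw [not_lt] at hle
      have := Real.sin_nonpos_of_nonpos_of_neg_pi_le hle hφ.1.le
      linarith
    · intro h; exact Real.sin_pos_of_pos_of_lt_pi h hφ.2
  have e3 : 0 < φ → (0 < r * Real.sin (α - φ) ↔ φ < α) := by
    intro hφ0
    rw [mul_pos_iff_of_pos_left hr]
    constructor
    · intro h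
      by_contra hle
      rw [not_lt] at hle
      have h1 : α - φ ≤ 0 := by linarith
      have h2 : -π ≤ α - φ := by linarith [hφ.2]
      have := Real.sin_nonpos_of_nonpos_of_neg_pi_le h1 h2
      linarith
    · intro h
      exact Real.sin_pos_of_pos_of_lt_pi (by linarith) (by linarith)
  rw [e1, e2]
  constructor
  · rintro ⟨h1, h2, h3⟩; exact ⟨h1, h2, (e3 h2).1 h3⟩
  · rintro ⟨h1, h2, h3⟩; exact ⟨h1, h2, (e3 h2).2 h3⟩

/-- Area of a sector by polar coordinates: `|sector₂ α ρ| = α · ∫_0^{√ρ} r dr`. [folklore] -/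
theorem volume_sector₂ {α : ℝ} (hα : 0 < α) (hαπ : α ≤ π) (ρ : ℝ) :
    volume (sector₂ α ρ) = radial ρ * ENNReal.ofReal α := by
  have hmeas := measurableSet_sector₂ α ρ
  have key := lintegral_comp_polarCoord_symm ((sector₂ α ρ).indicator 1)
  rw [lintegral_indicator_one hmeas] at key
  rw [← key]
  have htarget : polarCoord.target = Ioi (0 : ℝ) ×ˢ Ioo (-π) π := rfl
  -- on the target the integrand is the indicator of a rectangle
  have hcongr : EqOn (fun p : ℝ × ℝ => ENNReal.ofReal p.1 • (sector₂ α ρ).indicator 1 (polarCoord.symm p))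
      ((Ioo 0 (Real.sqrt ρ) ×ˢ Ioo 0 α).indicator fun p => ENNReal.ofReal p.1) polarCoord.target := by
    intro p hp
    rw [htarget] at hp
    obtain ⟨hr, hφ⟩ := hp
    simp only [mem_Ioi] at hr
    by_cases hmem : polarCoord.symm (p.1, p.2) ∈ sector₂ α ρ
    · have h' := (polarCoord_symm_mem_sector₂ (ρ := ρ) hα hαπ hr hφ).1 hmem
      have hrect : p ∈ Ioo 0 (Real.sqrt ρ) ×ˢ Ioo 0 α := ⟨⟨hr, h'.1⟩, ⟨h'.2.1, h'.2.2⟩⟩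
      simp only [indicator_of_mem hrect]
      rw [show (p.1, p.2) = p from rfl] at hmem
      rw [indicator_of_mem hmem, Pi.one_apply, smul_eq_mul, mul_one]
    · have hrect : p ∉ Ioo 0 (Real.sqrt ρ) ×ˢ Ioo 0 α := by
        intro h
        exact hmem ((polarCoord_symm_mem_sector₂ (ρ := ρ) hα hαπ hr hφ).2 ⟨h.1.2, h.2.1, h.2.2⟩)
      simp only [indicator_of_notMem hrect]
      rw [show (p.1, p.2) = p from rfl] at hmem
      rw [indicator_of_notMem hmem, smul_zero]
  rw [setLIntegral_congr_fun polarCoord.open_target.measurableSet hcongr]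
  have hsub : Ioo 0 (Real.sqrt ρ) ×ˢ Ioo 0 α ⊆ polarCoord.target := by
    rw [htarget]
    rintro ⟨r, φ⟩ ⟨⟨hr, -⟩, ⟨hφ1, hφ2⟩⟩
    exact ⟨hr, ⟨by linarith [Real.pi_pos], by linarith⟩⟩
  have hrectm : MeasurableSet (Ioo 0 (Real.sqrt ρ) ×ˢ Ioo (0 : ℝ) α) :=
    measurableSet_Ioo.prod measurableSet_Ioo
  rw [lintegral_indicator hrectm, Measure.restrict_restrict hrectm,
    inter_eq_self_of_subset_left hsub]
  rw [show (volume : Measure (ℝ × ℝ)) = (volume : Measure ℝ).prod (volume : Measure ℝ) from rfl,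
    ← Measure.prod_restrict]
  have hpm := lintegral_prod_mul (μ := volume.restrict (Ioo 0 (Real.sqrt ρ)))
    (ν := volume.restrict (Ioo (0 : ℝ) α)) (f := fun r : ℝ => ENNReal.ofReal r)
    (g := fun _ : ℝ => (1 : ℝ≥0∞)) (by fun_prop) (by fun_prop)
  simp only [lintegral_const, MeasurableSet.univ, Measure.restrict_apply, univ_inter, mul_one,
    Real.volume_Ioo, sub_zero] at hpm
  rw [hpm, one_mul]
  rfl

/-- Area of the disc by polar coordinates: `|disc₂ ρ| = 2π · ∫_0^{√ρ} r dr`. [folklore] -/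
theorem volume_disc₂ (ρ : ℝ) : volume (disc₂ ρ) = radial ρ * ENNReal.ofReal (2 * π) := by
  have hmeas := measurableSet_disc₂ ρ
  have key := lintegral_comp_polarCoord_symm ((disc₂ ρ).indicator 1)
  rw [lintegral_indicator_one hmeas] at key
  rw [← key]
  have htarget : polarCoord.target = Ioi (0 : ℝ) ×ˢ Ioo (-π) π := rfl
  have hcongr : EqOn (fun p : ℝ × ℝ => ENNReal.ofReal p.1 • (disc₂ ρ).indicator 1 (polarCoord.symm p))
      ((Ioo 0 (Real.sqrt ρ) ×ˢ Ioo (-π) π).indicator fun p => ENNReal.ofReal p.1)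
      polarCoord.target := by
    intro p hp
    rw [htarget] at hp
    obtain ⟨hr, hφ⟩ := hp
    simp only [mem_Ioi] at hr
    have hiff : polarCoord.symm (p.1, p.2) ∈ disc₂ ρ ↔ p.1 < Real.sqrt ρ := by
      rw [polarCoord_symm_apply]
      simp only [disc₂, mem_setOf_eq]
      have hr2 : (p.1 * Real.cos p.2) ^ 2 + (p.1 * Real.sin p.2) ^ 2 = p.1 ^ 2 := by
        nlinarith [Real.cos_sq_add_sin_sq p.2]
      rw [hr2, ← Real.sqrt_lt_sqrt_iff (sq_nonneg p.1), Real.sqrt_sq hr.le]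
    by_cases hmem : polarCoord.symm (p.1, p.2) ∈ disc₂ ρ
    · have hrect : p ∈ Ioo 0 (Real.sqrt ρ) ×ˢ Ioo (-π) π := ⟨⟨hr, hiff.1 hmem⟩, hφ⟩
      simp only [indicator_of_mem hrect]
      rw [show (p.1, p.2) = p from rfl] at hmem
      rw [indicator_of_mem hmem, Pi.one_apply, smul_eq_mul, mul_one]
    · have hrect : p ∉ Ioo 0 (Real.sqrt ρ) ×ˢ Ioo (-π) π := fun h => hmem (hiff.2 h.1.2)
      simp only [indicator_of_notMem hrect]
      rw [show (p.1, p.2) = p from rfl] at hmem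
      rw [indicator_of_notMem hmem, smul_zero]
  rw [setLIntegral_congr_fun polarCoord.open_target.measurableSet hcongr]
  have hsub : Ioo 0 (Real.sqrt ρ) ×ˢ Ioo (-π) π ⊆ polarCoord.target := by
    rw [htarget]
    rintro ⟨r, φ⟩ ⟨⟨hr, -⟩, hφ⟩
    exact ⟨hr, hφ⟩
  have hrectm : MeasurableSet (Ioo 0 (Real.sqrt ρ) ×ˢ Ioo (-π : ℝ) π) :=
    measurableSet_Ioo.prod measurableSet_Ioo
  rw [lintegral_indicator hrectm, Measure.restrict_restrict hrectm,
    inter_eq_self_of_subset_left hsub]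
  rw [show (volume : Measure (ℝ × ℝ)) = (volume : Measure ℝ).prod (volume : Measure ℝ) from rfl,
    ← Measure.prod_restrict]
  have hpm := lintegral_prod_mul (μ := volume.restrict (Ioo 0 (Real.sqrt ρ)))
    (ν := volume.restrict (Ioo (-π : ℝ) π)) (f := fun r : ℝ => ENNReal.ofReal r)
    (g := fun _ : ℝ => (1 : ℝ≥0∞)) (by fun_prop) (by fun_prop)
  simp only [lintegral_const, MeasurableSet.univ, Measure.restrict_apply, univ_inter, mul_one,
    Real.volume_Ioo] at hpm
  rw [hpm, one_mul, show π - -π = 2 * π by ring]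
  rfl

/-- **A sector of angle `α` is the fraction `α/(2π)` of the disc.** [folklore] -/
theorem volume_sector₂_eq {α : ℝ} (hα : 0 < α) (hαπ : α ≤ π) (ρ : ℝ) :
    volume (sector₂ α ρ) = ENNReal.ofReal (α / (2 * π)) * volume (disc₂ ρ) := by
  rw [volume_sector₂ hα hαπ, volume_disc₂]
  have h2π : (0 : ℝ) < 2 * π := by positivity
  rw [mul_comm (ENNReal.ofReal (α / (2 * π))), mul_assoc, ← ENNReal.ofReal_mul h2π.le,
    mul_div_cancel₀ _ h2π.ne']

/-! ### Dimension three: the round ball and the standard wedge -/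

/-- The open round ball `{x ⬝ᵥ x < R}` of `ℝ³` (the ambient norm of `Fin 3 → ℝ` is the sup norm,
so we define the Euclidean ball through the dot product). [folklore] -/
def ball₃ (R : ℝ) : Set (Fin 3 → ℝ) := {x | x ⬝ᵥ x < R}

/-- The standard open wedge of opening angle `α ∈ (0, π]` about the `x₂`-axis, between the half
planes of polar angles `0` and `α` in the `(x₀, x₁)`-plane. [folklore] -/
def stdWedge (α : ℝ) : Set (Fin 3 → ℝ) := {x | 0 < x 1 ∧ 0 < x 0 * Real.sin α - x 1 * Real.cos α}

/-- `x ⬝ᵥ x = x₀² + x₁² + x₂²`. [folklore] -/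
theorem dotProduct_self_fin3 (x : Fin 3 → ℝ) : x ⬝ᵥ x = x 0 ^ 2 + x 1 ^ 2 + x 2 ^ 2 := by
  simp [dotProduct, Fin.sum_univ_three]; ring

/-- The round ball is measurable. [folklore] -/
theorem measurableSet_ball₃ (R : ℝ) : MeasurableSet (ball₃ R) := by
  have hc : Continuous fun x : Fin 3 → ℝ => x ⬝ᵥ x := by unfold dotProduct; fun_prop
  exact (isOpen_lt hc continuous_const).measurableSet

/-- The standard wedge is measurable. [folklore] -/
theorem measurableSet_stdWedge (α : ℝ) : MeasurableSet (stdWedge α) := by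
  have h1 : MeasurableSet {x : Fin 3 → ℝ | 0 < x 1} :=
    (isOpen_lt continuous_const (continuous_apply 1)).measurableSet
  have h2 : MeasurableSet {x : Fin 3 → ℝ | 0 < x 0 * Real.sin α - x 1 * Real.cos α} :=
    (isOpen_lt continuous_const (by fun_prop)).measurableSet
  have : stdWedge α = {x : Fin 3 → ℝ | 0 < x 1} ∩ {x | 0 < x 0 * Real.sin α - x 1 * Real.cos α} := by
    ext x; simp [stdWedge]
  rw [this]; exact h1.inter h2

/-- Splitting `ℝ³` as (axis) × (plane): `x ↦ (x₂, (x₀, x₁))`, a measurable equivalence. [folklore] -/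
def axisPlane : (Fin 3 → ℝ) ≃ᵐ ℝ × (ℝ × ℝ) :=
  (MeasurableEquiv.piFinSuccAbove (fun _ => ℝ) 2).trans
    (MeasurableEquiv.prodCongr (MeasurableEquiv.refl ℝ) MeasurableEquiv.finTwoArrow)

/-- `axisPlane x = (x₂, (x₀, x₁))`. [folklore] -/
theorem axisPlane_apply (x : Fin 3 → ℝ) : axisPlane x = (x 2, (x 0, x 1)) := rfl

/-- `axisPlane` preserves Lebesgue measure (Fubini for product measures). [folklore] -/
theorem measurePreserving_axisPlane : MeasurePreserving axisPlane volume volume :=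
  (volume_preserving_piFinSuccAbove (fun _ => ℝ) 2).trans
    ((MeasurePreserving.id volume).prod (volume_preserving_finTwoArrow ℝ))

/-- Volume of a set of `ℝ³` described in the coordinates `(x₂, (x₀, x₁))`, by Fubini over the
axis coordinate. [folklore] -/
theorem volume_eq_lintegral_fiber {A : Set (Fin 3 → ℝ)} {A' : Set (ℝ × (ℝ × ℝ))}
    (hA' : MeasurableSet A') (h : A = axisPlane ⁻¹' A') :
    volume A = ∫⁻ z : ℝ, volume (Prod.mk z ⁻¹' A') := by
  rw [h, measurePreserving_axisPlane.measure_preimage hA'.nullMeasurableSet,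
    show (volume : Measure (ℝ × (ℝ × ℝ))) = (volume : Measure ℝ).prod volume from rfl,
    Measure.prod_apply hA']

/-- The ball in the coordinates `(x₂, (x₀, x₁))`. [folklore] -/
def ball₃' (R : ℝ) : Set (ℝ × (ℝ × ℝ)) := {p | p.2.1 ^ 2 + p.2.2 ^ 2 < R - p.1 ^ 2}

/-- The wedged ball in the coordinates `(x₂, (x₀, x₁))`. [folklore] -/
def wedgeBall' (α R : ℝ) : Set (ℝ × (ℝ × ℝ)) :=
  {p | p.2.1 ^ 2 + p.2.2 ^ 2 < R - p.1 ^ 2 ∧ 0 < p.2.2 ∧ 0 < p.2.1 * Real.sin α - p.2.2 * Real.cos α}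

/-- Measurability. [folklore] -/
theorem measurableSet_ball₃' (R : ℝ) : MeasurableSet (ball₃' R) :=
  (isOpen_lt (by fun_prop) (by fun_prop)).measurableSet

/-- Measurability. [folklore] -/
theorem measurableSet_wedgeBall' (α R : ℝ) : MeasurableSet (wedgeBall' α R) := by
  have h1 : MeasurableSet {p : ℝ × (ℝ × ℝ) | p.2.1 ^ 2 + p.2.2 ^ 2 < R - p.1 ^ 2} :=
    measurableSet_ball₃' R
  have h2 : MeasurableSet {p : ℝ × (ℝ × ℝ) | 0 < p.2.2} :=
    (isOpen_lt continuous_const (by fun_prop)).measurableSet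
  have h3 : MeasurableSet {p : ℝ × (ℝ × ℝ) | 0 < p.2.1 * Real.sin α - p.2.2 * Real.cos α} :=
    (isOpen_lt continuous_const (by fun_prop)).measurableSet
  have : wedgeBall' α R = {p : ℝ × (ℝ × ℝ) | p.2.1 ^ 2 + p.2.2 ^ 2 < R - p.1 ^ 2}
      ∩ {p | 0 < p.2.2} ∩ {p | 0 < p.2.1 * Real.sin α - p.2.2 * Real.cos α} := by
    ext p; simp [wedgeBall', and_assoc]
  rw [this]; exact (h1.inter h2).inter h3

/-- The ball in axis/plane coordinates. [folklore] -/
theorem ball₃_eq_preimage (R : ℝ) : ball₃ R = axisPlane ⁻¹' ball₃' R := by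
  ext x
  simp only [ball₃, mem_setOf_eq, mem_preimage, axisPlane_apply, ball₃', dotProduct_self_fin3]
  constructor <;> intro h <;> linarith

/-- The wedged ball in axis/plane coordinates. [folklore] -/
theorem stdWedge_inter_ball₃_eq_preimage (α R : ℝ) :
    stdWedge α ∩ ball₃ R = axisPlane ⁻¹' wedgeBall' α R := by
  ext x
  simp only [stdWedge, ball₃, mem_inter_iff, mem_setOf_eq, mem_preimage, axisPlane_apply,
    wedgeBall', dotProduct_self_fin3]
  constructor
  · rintro ⟨⟨h1, h2⟩, h3⟩; exact ⟨by linarith, h1, h2⟩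
  · rintro ⟨h1, h2, h3⟩; exact ⟨⟨h2, h3⟩, by linarith⟩

/-- The fibres of the ball over the axis are discs. [folklore] -/
theorem fiber_ball₃' (R z : ℝ) : Prod.mk z ⁻¹' ball₃' R = disc₂ (R - z ^ 2) := by
  ext w; simp [ball₃', disc₂]

/-- The fibres of the wedged ball over the axis are sectors. [folklore] -/
theorem fiber_wedgeBall' (α R z : ℝ) : Prod.mk z ⁻¹' wedgeBall' α R = sector₂ α (R - z ^ 2) := by
  ext w; simp [wedgeBall', sector₂]

/-- **The standard wedge of opening angle `α ∈ (0, π]` occupies the fraction `α/(2π)` of the round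
ball.** [folklore] -/
theorem volume_stdWedge_inter_ball₃ {α : ℝ} (hα : 0 < α) (hαπ : α ≤ π) (R : ℝ) :
    volume (stdWedge α ∩ ball₃ R) = ENNReal.ofReal (α / (2 * π)) * volume (ball₃ R) := by
  rw [volume_eq_lintegral_fiber (measurableSet_wedgeBall' α R) (stdWedge_inter_ball₃_eq_preimage α R),
    volume_eq_lintegral_fiber (measurableSet_ball₃' R) (ball₃_eq_preimage R)]
  simp_rw [fiber_ball₃', fiber_wedgeBall', volume_sector₂_eq hα hαπ]
  rw [lintegral_const_mul' _ _ ENNReal.ofReal_ne_top]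

end KY

end Literature.Analysis.FluidPDE
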